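import Summits.MatrixMultiplication.MatrixMultiplication.Theorems.EdgePencilFlatSummand
import Summits.MatrixMultiplication.MatrixMultiplication.Theorems.EdgePencilSixthCertificates
import HarnessLib


/-!
# The price of a flat summand is not inherited: `W_n^{(⌈n^δ⌉)} ≲ D_n ⊕ ⟨n⁴⟩` at infinitely
# many levels gives the RUNG `χ(δ) ≤ ω(2,1,2)`; contrast with the absolute purchase; NEC

Support kernel for `stmt-MatrixMultiplication-26697` (`TetraExcessZero`; route `TetrahedronCarving`, cut
UNCHANGED; lineage `decomp-mm-lens-6`, generation 42), companion of `EdgePencilFlatSummand` (notation and the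
typed target `RUNG♭(δ, n) : [W_n^{(⌈n^δ⌉)}] ≲ [D_n] + n⁴` in `T₄(F) = DTensorClass F 4` there, spelled
out as the displayed `AsympLe` in every statement).

* §3 THE PRICE IS NOT INHERITED (`sixRung_of_flatPurchase`): a flat-summand purchase at infinitely many
  levels `n` gives the RUNG `χ(δ) ≤ ψ` — with NO `HalfAlpha`, no `ψ = 4`: the summand `⟨n⁴⟩` costs `n⁴`,
  which sits at or below the flattening floor `4 ≤ ψ` of the diamond it accompanies, so
  `R([D_n] + n⁴) ≤ R₄(D_n) + n⁴ ≤ 2·n^{ψ+o(1)}` and the factor `2` dies in the exponent as `n → ∞` (a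
  purchase at ONE level only gives `χ(δ) ≤ ψ + log 2/log n`, whence "infinitely many levels"). Analytic
  core: `omegaSix_le_of_asympLe` (asymptotic restriction from ANY class of rank `n^{θ+o(1)}` at infinitely
  many levels gives `χ(δ) ≤ θ`) over `omegaSix_le_of_levels` (ranks along the powers of one level, with a
  subexponential slack, bound the exponent; `[W_n^{(e)}]^k = [W_{n^k}^{(e^k)}]` is `mk_sixTetra_pow`).
  By name over `ℂ`: `sixRungPos_of_flatPurchase` discharges the shape of `stub_sixRungPos` from
  `∃ δ ∈ (0,1]` with purchases at infinitely many levels; at `δ = 1` (`tetraExcessZero_of_flatPurchase_one`)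
  the purchase `T(K₄)_n ≲ D_n ⊕ ⟨n⁴⟩` gives the LEAF `TetraExcessZero` by name.
  CONTRAST (`omegaSix_le_four_of_absolutePurchase`, `halfAlpha_of_absolutePurchase`): drop the diamond and
  the same purchase `W ≲ ⟨n⁴⟩` is absolute, gives `χ(δ) ≤ 4`, hence `HalfAlpha ∧ ψ = 4 ∧ χ(δ) = 4` — the
  recorded all-or-nothing (`absRung_iff_halfAlpha_and_sixRungPos`). So the amended barrier note reads: an
  absolute NUMBER on the target side is fatal only ABOVE the flattening floor of the accompanying class.
* §4 NEC (`flatPurchase_of_matrixMultiplication`, via `flatPurchase_of_omegaTetra_le_four`,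
  `flatPurchase_of_tetraFlat`): `ω = 2` (indeed already `TetraFlat`) gives the purchase at every `δ ≤ 1` and
  every level `n ≥ 2`; under `ω(K₄) ≤ 4` even the absolute purchase `[W_n^{(e)}] ≲ n⁴` holds
  (`absolutePurchase_of_omegaTetra_le_four`, explicit subexponential slack `⌊R₄(W_{n^k}^{(e^k)})/n^{4k}⌋ + 1`,
  subexponential because `R₄(T(K₄)_m) ≤ C_η m^{4+η}` for every `η > 0` and `n^η = 1 + ε'` is solvable).
  Hence the purchase sits in the chain `TetraFlat ⟹ (∀ δ ≤ 1, ∀ n ≥ 2, RUNG♭(δ, n)) ⟹ RUNG(δ)`.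

References: Strassen 1988 [Strassen1988]; Zuiddam 2018, §2.8, Thm. 2.12 [Zuiddam2018]; Christandl–Vrana–
Zuiddam 2023, Thm. 1.1 [ChristandlVranaZuiddam2023]; Christandl–Vrana–Zuiddam, arXiv:1609.07476, §1.1,
Prop. 1.1.16 [ChristandlVranaZuiddam2016]. No `sorry`, no new axiom, no instance, no notation, no definition.
-/

noncomputable section

set_option linter.dupNamespace false

open Filter Asymptotics Finset Literature.Computability.AlgebraicComplexity
open Summit.MatrixMultiplication.MatrixMultiplication.Theorems.TetrahedronTensor
open Summit.MatrixMultiplication.MatrixMultiplication.Theorems.TetraDiagonal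
open Summit.MatrixMultiplication.MatrixMultiplication.Theses.TetrahedronCarving

namespace Summit.MatrixMultiplication.MatrixMultiplication.Theorems.EdgePencil

/-! ## §3 The price of a flat summand is not inherited -/

section Price

variable (F : Type) [Field F]

/-- **LEVELS ⟹ EXPONENT with a subexponential slack.** If along the powers of one level `n ≥ 2` the
ranks obey `R₄(W_{n^{k+1}}^{(⌈n^δ⌉^{k+1})}) ≤ f(k+1) · (n^θ)^{k+1}` with `f` subexponential, then
`χ(δ) ≤ θ`: for `n^k ≤ m < n^{k+1}`, level and bond monotonicity and `⌈m^δ⌉ ≤ ⌈n^δ⌉^{k+1}` give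
`R₄(W_m^{(⌈m^δ⌉)}) ≤ C_η n^{η(k+1)} (n^θ)^{k+1} ≤ C_η (n·m)^{θ+η}` for every `η > 0`.
[cite: ChristandlVranaZuiddam2016, Prop. 1.1.16] -/
theorem omegaSix_le_of_levels {n : ℕ} (hn : 2 ≤ n) {δ : ℝ} (hδ0 : 0 ≤ δ) {θ : ℝ} (hθ : 0 ≤ θ)
    {f : ℕ → ℕ} (hf : IsSubexponential f)
    (h : ∀ k : ℕ, (tensorRankD (sixTetra F (n ^ (k + 1)) (rectDim n δ ^ (k + 1))) : ℝ) ≤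
      (f (k + 1) : ℝ) * ((n : ℝ) ^ θ) ^ (k + 1)) :
    omegaSix F δ ≤ θ := by
  refine le_of_forall_pos_le_add fun η hη => ?_
  have hn0 : (0 : ℝ) < n := by exact_mod_cast (by omega : 0 < n)
  have hn1' : (1 : ℝ) < n := by exact_mod_cast (by omega : 1 < n)
  -- the slack with ratio `n^η > 1`
  have hε : 0 < (n : ℝ) ^ η - 1 := by
    have := Real.one_lt_rpow hn1' hη
    linarith
  obtain ⟨C, hC⟩ := hf _ hε
  have hC' : ∀ N : ℕ, (f N : ℝ) ≤ C * ((n : ℝ) ^ η) ^ N := fun N => by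
    have h1 := hC N
    rwa [show (1 : ℝ) + ((n : ℝ) ^ η - 1) = (n : ℝ) ^ η by ring] at h1
  have hC0 : 0 ≤ C := by
    have h1 := hC' 0
    rw [pow_zero, mul_one] at h1
    exact (Nat.cast_nonneg _).trans h1
  -- the bound at every level `m ≥ 1`
  have key : ∀ m : ℕ, 1 ≤ m →
      (tensorRankD (sixTetra F m (rectDim m δ)) : ℝ) ≤ C * (n : ℝ) ^ (θ + η) * (m : ℝ) ^ (θ + η) := by
    intro m hm
    set k : ℕ := Nat.log n m with hk
    have hlt : m < n ^ (k + 1) := Nat.lt_pow_succ_log_self (by omega) m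
    have hle : n ^ k ≤ m := Nat.pow_log_le_self n (by omega)
    have hnat : tensorRankD (sixTetra F m (rectDim m δ)) ≤
        tensorRankD (sixTetra F (n ^ (k + 1)) (rectDim n δ ^ (k + 1))) :=
      calc tensorRankD (sixTetra F m (rectDim m δ))
          ≤ tensorRankD (sixTetra F (n ^ (k + 1)) (rectDim m δ)) :=
            tensorRankD_sixTetra_mono_level hlt.le _
        _ ≤ tensorRankD (sixTetra F (n ^ (k + 1)) (rectDim (n ^ (k + 1)) δ)) :=
            tensorRankD_sixTetra_mono (rectDim_mono_left hlt.le hδ0)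
        _ ≤ tensorRankD (sixTetra F (n ^ (k + 1)) (rectDim n δ ^ (k + 1))) :=
            tensorRankD_sixTetra_mono (rectDim_pow_le n (k + 1) δ)
    have h1 : (tensorRankD (sixTetra F m (rectDim m δ)) : ℝ) ≤
        (f (k + 1) : ℝ) * ((n : ℝ) ^ θ) ^ (k + 1) :=
      le_trans (by exact_mod_cast hnat) (h k)
    have h2 : (f (k + 1) : ℝ) * ((n : ℝ) ^ θ) ^ (k + 1) ≤
        C * ((n : ℝ) ^ η) ^ (k + 1) * ((n : ℝ) ^ θ) ^ (k + 1) :=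
      mul_le_mul_of_nonneg_right (hC' (k + 1)) (by positivity)
    have h3 : ((n : ℝ) ^ η) ^ (k + 1) * ((n : ℝ) ^ θ) ^ (k + 1) =
        (((n ^ (k + 1) : ℕ) : ℝ)) ^ (θ + η) := by
      rw [← mul_pow, ← Real.rpow_add hn0, ← Real.rpow_mul_natCast hn0.le, Nat.cast_pow,
        ← Real.rpow_natCast_mul hn0.le]
      congr 1
      ring
    have h4 : (((n ^ (k + 1) : ℕ) : ℝ)) ^ (θ + η) ≤ ((n : ℝ) * m) ^ (θ + η) := by
      refine Real.rpow_le_rpow (Nat.cast_nonneg _) ?_ (by linarith)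
      have h5 : n ^ (k + 1) ≤ n * m := by
        rw [pow_succ, mul_comm]
        exact Nat.mul_le_mul_left n hle
      exact_mod_cast h5
    calc (tensorRankD (sixTetra F m (rectDim m δ)) : ℝ)
        ≤ C * ((n : ℝ) ^ η) ^ (k + 1) * ((n : ℝ) ^ θ) ^ (k + 1) := h1.trans h2
      _ = C * (((n ^ (k + 1) : ℕ) : ℝ)) ^ (θ + η) := by rw [mul_assoc, h3]
      _ ≤ C * (((n : ℝ) * m) ^ (θ + η)) := mul_le_mul_of_nonneg_left h4 hC0
      _ = C * (n : ℝ) ^ (θ + η) * (m : ℝ) ^ (θ + η) := by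
          rw [Real.mul_rpow hn0.le (Nat.cast_nonneg _), mul_assoc]
  have hmem : θ + η ∈ sixAdmissibleExponents F δ := by
    refine IsBigO.of_bound (C * (n : ℝ) ^ (θ + η)) ?_
    filter_upwards [eventually_ge_atTop 1] with m hm
    rw [Real.norm_of_nonneg (Nat.cast_nonneg _),
      Real.norm_of_nonneg (Real.rpow_nonneg (Nat.cast_nonneg _) _)]
    exact key m hm
  exact csInf_le (sixAdmissibleExponents_bddBelow F δ) hmem

/-- **CORE: asymptotic restriction from a cheap class, at infinitely many levels, bounds `χ(δ)`.** If for
every `ε > 0` there are arbitrarily large levels `n` and classes `c ∈ T₄(F)` with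
`[W_n^{(⌈n^δ⌉)}] ≲ c` and `R(c) ≤ n^{θ+ε}`, then `χ(δ) ≤ θ` (`0 ≤ δ ≤ 1`): the powers are levels
(`mk_sixTetra_pow`), `R([W]^{k}) ≤ f(k)·R(c)^k`, and `omegaSix_le_of_levels`. [cite: Zuiddam2018, §2.8] -/
theorem omegaSix_le_of_asympLe {δ θ : ℝ} (hδ0 : 0 ≤ δ) (hδ1 : δ ≤ 1) (hθ : 0 ≤ θ)
    (h : ∀ ε : ℝ, 0 < ε → ∀ n₀ : ℕ, ∃ n : ℕ, n₀ ≤ n ∧ ∃ c : DTensorClass F 4,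
      AsympLe (fun x y : DTensorClass F 4 => x ≤ y)
          (DTensorClass.mk (sixTetra F n (rectDim n δ))) c ∧
        (rankOf (fun x y : DTensorClass F 4 => x ≤ y) c : ℝ) ≤ (n : ℝ) ^ (θ + ε)) :
    omegaSix F δ ≤ θ := by
  have hSP : IsStrassenPreorder (fun x y : DTensorClass F 4 => x ≤ y) :=
    DTensorClass.isStrassenPreorder F 2
  refine le_of_forall_pos_le_add fun ε hε => ?_
  obtain ⟨n, hn2, c, hwc, hc⟩ := h ε hε 2
  unfold AsympLe at hwc
  obtain ⟨f, hf, hle⟩ := hwc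
  have hn1 : 1 ≤ n := by omega
  have hn0 : (0 : ℝ) ≤ n := Nat.cast_nonneg n
  have he : rectDim n δ ≤ n := by simpa using rectDim_mono hn1 hδ1
  refine omegaSix_le_of_levels F hn2 hδ0 (by linarith) hf fun k => ?_
  have h1 : tensorRankD (sixTetra F (n ^ (k + 1)) (rectDim n δ ^ (k + 1))) =
      rankOf (fun x y : DTensorClass F 4 => x ≤ y)
        (DTensorClass.mk (sixTetra F n (rectDim n δ)) ^ (k + 1)) := by
    rw [mk_sixTetra_pow he, rankOf_mk_sixTetra]
  have h2 : rankOf (fun x y : DTensorClass F 4 => x ≤ y)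
        (DTensorClass.mk (sixTetra F n (rectDim n δ)) ^ (k + 1)) ≤
      f (k + 1) * rankOf (fun x y : DTensorClass F 4 => x ≤ y) c ^ (k + 1) :=
    (hSP.rankOf_mono (hle (k + 1))).trans
      ((hSP.rankOf_natCast_mul_le _ _).trans (Nat.mul_le_mul_left _ (hSP.rankOf_pow_le _ _)))
  have h3 : (tensorRankD (sixTetra F (n ^ (k + 1)) (rectDim n δ ^ (k + 1))) : ℝ) ≤
      (f (k + 1) : ℝ) * ((rankOf (fun x y : DTensorClass F 4 => x ≤ y) c : ℝ)) ^ (k + 1) := by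
    rw [h1]
    exact_mod_cast h2
  refine h3.trans (mul_le_mul_of_nonneg_left ?_ (Nat.cast_nonneg _))
  exact pow_le_pow_left₀ (Nat.cast_nonneg _) hc _

/-- **THE PRICE IS NOT INHERITED.** A flat-summand purchase `[W_n^{(⌈n^δ⌉)}] ≲ [D_n] + n⁴` at
infinitely many levels `n` gives the RUNG `χ(δ) ≤ ψ = ω(2,1,2)` (`0 ≤ δ ≤ 1`) — no `HalfAlpha`, no
`ψ = 4`: `R([D_n] + n⁴) ≤ R₄(D_n) + n⁴ ≤ C n^{ψ+ε/2} + n⁴ ≤ (C+1) n^{ψ+ε/2} ≤ n^{ψ+ε}` for large `n`,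
because the summand's exponent `4` is at most the flattening floor `4 ≤ ψ` of the diamond.
[cite: Zuiddam2018, Thm. 2.12] -/
theorem sixRung_of_flatPurchase {δ : ℝ} (hδ0 : 0 ≤ δ) (hδ1 : δ ≤ 1)
    (h : ∀ n₀ : ℕ, ∃ n : ℕ, n₀ ≤ n ∧
      AsympLe (fun x y : DTensorClass F 4 => x ≤ y) (DTensorClass.mk (sixTetra F n (rectDim n δ)))
        (DTensorClass.mk (sixTetra F n 1) + ((n ^ 4 : ℕ) : DTensorClass F 4))) :
    omegaSix F δ ≤ omegaRect F 2 1 2 := by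
  have hSP : IsStrassenPreorder (fun x y : DTensorClass F 4 => x ≤ y) :=
    DTensorClass.isStrassenPreorder F 2
  have hψ4 : 4 ≤ omegaRect F 2 1 2 := four_le_omegaRect_two_one_two F
  refine omegaSix_le_of_asympLe F hδ0 hδ1 (by linarith) fun ε hε n₀ => ?_
  -- a bound on the diamond: `R₄(D_m) ≤ C m^β`, `β < ψ + ε/2`, from `χ(0) = ψ`
  have hlt : sInf (sixAdmissibleExponents F 0) < omegaRect F 2 1 2 + ε / 2 := by
    have h0 := omegaSix_zero F
    unfold omegaSix at h0
    rw [h0]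
    linarith
  obtain ⟨β, hβ, hβlt⟩ := exists_lt_of_csInf_lt (sixAdmissibleExponents_nonempty F 0) hlt
  obtain ⟨C, hC0, hC⟩ := exists_bound_of_mem_sixAdmissibleExponents F hβ
  -- levels with `C + 1 ≤ n^{ε/2}`
  obtain ⟨n₁, hn₁⟩ : ∃ n₁ : ℕ, ∀ n : ℕ, n₁ ≤ n → C + 1 ≤ (n : ℝ) ^ (ε / 2) := by
    have ht : Tendsto (fun n : ℕ => (n : ℝ) ^ (ε / 2)) atTop atTop :=
      (tendsto_rpow_atTop (by linarith)).comp tendsto_natCast_atTop_atTop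
    exact (ht.eventually_ge_atTop (C + 1)).exists_forall_of_atTop
  obtain ⟨n, hn, hP⟩ := h (max (max n₀ 2) n₁)
  have hn₀ : n₀ ≤ n := le_trans (le_trans (le_max_left _ _) (le_max_left _ _)) hn
  have hn2 : 2 ≤ n := le_trans (le_trans (le_max_right _ _) (le_max_left _ _)) hn
  have hnn₁ : n₁ ≤ n := le_trans (le_max_right _ _) hn
  have hn1 : 1 ≤ n := by omega
  have hn0 : (0 : ℝ) < n := by exact_mod_cast (by omega : 0 < n)
  have hn1' : (1 : ℝ) ≤ n := by exact_mod_cast hn1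
  refine ⟨n, hn₀, _, hP, ?_⟩
  have hR : rankOf (fun x y : DTensorClass F 4 => x ≤ y)
      (DTensorClass.mk (sixTetra F n 1) + ((n ^ 4 : ℕ) : DTensorClass F 4)) ≤
        tensorRankD (sixTetra F n 1) + n ^ 4 := by
    refine (rankOf_add_le hSP _ _).trans (le_of_eq ?_)
    rw [rankOf_mk_sixTetra, hSP.rankOf_natCast]
  have hD : (tensorRankD (sixTetra F n 1) : ℝ) ≤ C * (n : ℝ) ^ β := by
    have h1 := hC n hn1
    rwa [rectDim_zero] at h1
  have hβ' : (n : ℝ) ^ β ≤ (n : ℝ) ^ (omegaRect F 2 1 2 + ε / 2) :=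
    Real.rpow_le_rpow_of_exponent_le hn1' hβlt.le
  have h4 : ((n ^ 4 : ℕ) : ℝ) ≤ (n : ℝ) ^ (omegaRect F 2 1 2 + ε / 2) := by
    rw [Nat.cast_pow, ← Real.rpow_natCast]
    exact Real.rpow_le_rpow_of_exponent_le hn1' (by push_cast; linarith)
  calc (rankOf (fun x y : DTensorClass F 4 => x ≤ y)
          (DTensorClass.mk (sixTetra F n 1) + ((n ^ 4 : ℕ) : DTensorClass F 4)) : ℝ)
      ≤ (tensorRankD (sixTetra F n 1) : ℝ) + ((n ^ 4 : ℕ) : ℝ) := by exact_mod_cast hR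
    _ ≤ C * (n : ℝ) ^ (omegaRect F 2 1 2 + ε / 2) + (n : ℝ) ^ (omegaRect F 2 1 2 + ε / 2) :=
        add_le_add (hD.trans (mul_le_mul_of_nonneg_left hβ' hC0.le)) h4
    _ = (C + 1) * (n : ℝ) ^ (omegaRect F 2 1 2 + ε / 2) := by ring
    _ ≤ (n : ℝ) ^ (ε / 2) * (n : ℝ) ^ (omegaRect F 2 1 2 + ε / 2) :=
        mul_le_mul_of_nonneg_right (hn₁ n hnn₁) (Real.rpow_nonneg hn0.le _)
    _ = (n : ℝ) ^ (omegaRect F 2 1 2 + ε) := by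
        rw [← Real.rpow_add hn0]
        congr 1
        ring

/-- **CONTRAST — the absolute purchase is all-or-nothing.** Dropping the diamond, a purchase
`[W_n^{(⌈n^δ⌉)}] ≲ n⁴` at infinitely many levels gives the ABSOLUTE rung `χ(δ) ≤ 4`.
[cite: Zuiddam2018, Thm. 2.12] -/
theorem omegaSix_le_four_of_absolutePurchase {δ : ℝ} (hδ0 : 0 ≤ δ) (hδ1 : δ ≤ 1)
    (h : ∀ n₀ : ℕ, ∃ n : ℕ, n₀ ≤ n ∧ AsympLe (fun x y : DTensorClass F 4 => x ≤ y)
      (DTensorClass.mk (sixTetra F n (rectDim n δ))) ((n ^ 4 : ℕ) : DTensorClass F 4)) :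
    omegaSix F δ ≤ 4 := by
  have hSP : IsStrassenPreorder (fun x y : DTensorClass F 4 => x ≤ y) :=
    DTensorClass.isStrassenPreorder F 2
  refine omegaSix_le_of_asympLe F hδ0 hδ1 (by norm_num) fun ε hε n₀ => ?_
  obtain ⟨n, hn, hA⟩ := h (max n₀ 1)
  have hn1 : 1 ≤ n := le_trans (le_max_right _ _) hn
  refine ⟨n, le_trans (le_max_left _ _) hn, _, hA, ?_⟩
  rw [hSP.rankOf_natCast, Nat.cast_pow, ← Real.rpow_natCast]
  exact Real.rpow_le_rpow_of_exponent_le (by exact_mod_cast hn1) (by push_cast; linarith)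

/-! ### By name over `ℂ` -/

/-- **`stub_sixRungPos` from a flat-summand purchase**: purchases at infinitely many levels for ONE
`δ ∈ (0,1]` give `∃ δ > 0, χ(δ) ≤ ω(2,1,2)` — the RUNG of the registered line «rung-and-chord», with
no absolute number and no inherited price. [cite: ChristandlVranaZuiddam2016, §1.1] -/
theorem sixRungPos_of_flatPurchase
    (h : ∃ δ : ℝ, 0 < δ ∧ δ ≤ 1 ∧ ∀ n₀ : ℕ, ∃ n : ℕ, n₀ ≤ n ∧
      AsympLe (fun x y : DTensorClass ℂ 4 => x ≤ y) (DTensorClass.mk (sixTetra ℂ n (rectDim n δ)))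
        (DTensorClass.mk (sixTetra ℂ n 1) + ((n ^ 4 : ℕ) : DTensorClass ℂ 4))) :
    ∃ δ : ℝ, 0 < δ ∧ omegaSix ℂ δ ≤ omegaRect ℂ 2 1 2 := by
  obtain ⟨δ, hδ, hδ1, h⟩ := h
  exact ⟨δ, hδ, sixRung_of_flatPurchase ℂ hδ.le hδ1 h⟩

/-- **The leaf from the top purchase**: `T(K₄)_n ≲ D_n ⊕ ⟨n⁴⟩` at infinitely many levels gives
`TetraExcessZero` BY NAME (`χ(1) = ω(K₄)`). (By the `Aut(K₄)`-symmetry of `T(K₄)` this purchase is in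
fact `TetraFlat`-strong — memo NODE-g42; only the leaf is proved here.)
[cite: ChristandlVranaZuiddam2016, §1.1] -/
theorem tetraExcessZero_of_flatPurchase_one
    (h : ∀ n₀ : ℕ, ∃ n : ℕ, n₀ ≤ n ∧
      AsympLe (fun x y : DTensorClass ℂ 4 => x ≤ y) (DTensorClass.mk (sixTetra ℂ n (rectDim n 1)))
        (DTensorClass.mk (sixTetra ℂ n 1) + ((n ^ 4 : ℕ) : DTensorClass ℂ 4))) :
    TetraExcessZero := by
  have h1 := sixRung_of_flatPurchase ℂ zero_le_one le_rfl h
  rw [omegaSix_one] at h1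
  exact h1

/-- **CONTRAST by name**: the absolute purchase at infinitely many levels proves `HalfAlpha` (and pins
`ψ = χ(δ) = 4`) — the recorded all-or-nothing `absRung_iff_halfAlpha_and_sixRungPos`; the flat-summand
purchase does not. [cite: ChristandlVranaZuiddam2016, §1.1] -/
theorem halfAlpha_of_absolutePurchase {δ : ℝ} (hδ0 : 0 ≤ δ) (hδ1 : δ ≤ 1)
    (h : ∀ n₀ : ℕ, ∃ n : ℕ, n₀ ≤ n ∧ AsympLe (fun x y : DTensorClass ℂ 4 => x ≤ y)
      (DTensorClass.mk (sixTetra ℂ n (rectDim n δ))) ((n ^ 4 : ℕ) : DTensorClass ℂ 4)) :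
    HalfAlpha ∧ omegaRect ℂ 2 1 2 = 4 ∧ omegaSix ℂ δ = 4 :=
  halfAlpha_of_omegaSix_le_four (omegaSix_le_four_of_absolutePurchase ℂ hδ0 hδ1 h)

end Price

/-! ## §4 NEC: under `ω(K₄) ≤ 4` (in particular under `ω = 2`) the purchase holds at every level -/

section Nec

variable (F : Type) [Field F]

/-- **Under `ω(K₄) ≤ 4` every member is absolutely flat in `T₄(F)`**: `[W_n^{(e)}] ≲ n⁴` for `n ≥ 2`,
`e ≤ n`, with the explicit subexponential slack `f(k) = ⌊R₄(W_{n^k}^{(e^k)})/n^{4k}⌋ + 1`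
(`R₄(W_{n^k}^{(e^k)}) ≤ R₄(T(K₄)_{n^k}) ≤ C_η n^{k(4+η)}` for every `η > 0`).
[cite: Zuiddam2018, Def. 2.1] -/
theorem absolutePurchase_of_omegaTetra_le_four (hT : omegaTetra F ≤ 4) {n e : ℕ} (hn : 2 ≤ n)
    (he : e ≤ n) :
    AsympLe (fun x y : DTensorClass F 4 => x ≤ y) (DTensorClass.mk (sixTetra F n e))
      ((n ^ 4 : ℕ) : DTensorClass F 4) := by
  classical
  have hn1 : 1 ≤ n := by omega
  have hn0 : (0 : ℝ) < n := by exact_mod_cast (by omega : 0 < n)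
  have hn1' : (1 : ℝ) < n := by exact_mod_cast (by omega : 1 < n)
  -- the slack
  refine ⟨fun k => tensorRankD (sixTetra F (n ^ k) (e ^ k)) / n ^ (4 * k) + 1, ?_, ?_⟩
  · -- subexponential: for `ε' > 0` take `η = log_n (1 + ε')`, so `n^η = 1 + ε'`
    intro ε' hε'
    set η : ℝ := Real.logb n (1 + ε') with hηdef
    have hη : 0 < η := Real.logb_pos hn1' (by linarith)
    have hnη : (n : ℝ) ^ η = 1 + ε' := by
      rw [hηdef, Real.rpow_logb hn0 hn1'.ne' (by linarith)]
    -- `R₄(T(K₄)_m) = R₄(W_m^{(m)}) ≤ C m^{β}`, `β < 4 + η`, from `χ(1) = ω(K₄) ≤ 4`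
    have hlt : sInf (sixAdmissibleExponents F 1) < 4 + η := by
      have h0 := omegaSix_one F
      unfold omegaSix at h0
      rw [h0]
      linarith
    obtain ⟨β, hβ, hβlt⟩ := exists_lt_of_csInf_lt (sixAdmissibleExponents_nonempty F 1) hlt
    obtain ⟨C, hC0, hC⟩ := exists_bound_of_mem_sixAdmissibleExponents F hβ
    refine ⟨C + 1, fun k => ?_⟩
    have hm1 : 1 ≤ n ^ k := Nat.one_le_pow _ _ (by omega)
    have hm0 : (0 : ℝ) < ((n ^ k : ℕ) : ℝ) := by exact_mod_cast (by omega : 0 < n ^ k)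
    -- the rank at level `n^k`
    have hR : (tensorRankD (sixTetra F (n ^ k) (e ^ k)) : ℝ) ≤ C * ((n : ℝ) ^ k) ^ (4 + η) := by
      have h1 : tensorRankD (sixTetra F (n ^ k) (e ^ k)) ≤
          tensorRankD (sixTetra F (n ^ k) (rectDim (n ^ k) 1)) := by
        rw [rectDim_one]
        exact tensorRankD_sixTetra_mono (Nat.pow_le_pow_left he k)
      have h2 := hC (n ^ k) hm1
      have h3 : ((n ^ k : ℕ) : ℝ) ^ β ≤ ((n : ℝ) ^ k) ^ (4 + η) := by
        rw [← Nat.cast_pow]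
        exact Real.rpow_le_rpow_of_exponent_le (by exact_mod_cast hm1) hβlt.le
      exact (le_trans (by exact_mod_cast h1) h2).trans (mul_le_mul_of_nonneg_left h3 hC0.le)
    -- `((n:ℝ)^k)^(4+η) = n^{4k} · (n^η)^k`
    have hsplit : ((n : ℝ) ^ k) ^ (4 + η) = (n : ℝ) ^ (4 * k) * ((n : ℝ) ^ η) ^ k := by
      rw [← Real.rpow_natCast_mul hn0.le,
        show (k : ℝ) * (4 + η) = ((4 * k : ℕ) : ℝ) + η * k by push_cast; ring,
        Real.rpow_add hn0, Real.rpow_natCast, Real.rpow_mul_natCast hn0.le]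
    have hpos : (0 : ℝ) < (n : ℝ) ^ (4 * k) := by positivity
    -- `f(k) ≤ R / n^{4k} + 1 ≤ C (n^η)^k + 1 ≤ (C + 1) (1 + ε')^k`
    have hdiv : (((tensorRankD (sixTetra F (n ^ k) (e ^ k)) / n ^ (4 * k) + 1 : ℕ)) : ℝ) ≤
        (tensorRankD (sixTetra F (n ^ k) (e ^ k)) : ℝ) / (n : ℝ) ^ (4 * k) + 1 := by
      have h1 : (((tensorRankD (sixTetra F (n ^ k) (e ^ k)) / n ^ (4 * k) : ℕ)) : ℝ) ≤
          (tensorRankD (sixTetra F (n ^ k) (e ^ k)) : ℝ) / ((n ^ (4 * k) : ℕ) : ℝ) :=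
        Nat.cast_div_le
      push_cast at h1 ⊢
      linarith
    have hone : (1 : ℝ) ≤ (1 + ε') ^ k := one_le_pow₀ (by linarith)
    calc (((tensorRankD (sixTetra F (n ^ k) (e ^ k)) / n ^ (4 * k) + 1 : ℕ)) : ℝ)
        ≤ (tensorRankD (sixTetra F (n ^ k) (e ^ k)) : ℝ) / (n : ℝ) ^ (4 * k) + 1 := hdiv
      _ ≤ C * ((n : ℝ) ^ k) ^ (4 + η) / (n : ℝ) ^ (4 * k) + 1 :=
          add_le_add (div_le_div_of_nonneg_right hR hpos.le) le_rfl
      _ = C * (1 + ε') ^ k + 1 := by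
          rw [hsplit, hnη]
          field_simp
      _ ≤ (C + 1) * (1 + ε') ^ k := by nlinarith
  · -- the inequality `[W]^k ≤ f(k) · (n⁴)^k`
    intro k
    have hcast : (((n ^ 4 : ℕ) : DTensorClass F 4)) ^ k = ((n ^ (4 * k) : ℕ) : DTensorClass F 4) := by
      rw [← Nat.cast_pow, ← pow_mul]
    rw [hcast, ← Nat.cast_mul, ]
    rcases k with _ | k
    · -- `k = 0`: `1 ≤ f(0) · 1`
      rw [pow_zero]
      have h1 : (1 : DTensorClass F 4) = ((1 : ℕ) : DTensorClass F 4) := Nat.cast_one.symm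
      rw [h1, DTensorClass.natCast_le_natCast_iff]
      simp
    · rw [mk_sixTetra_pow he, DTensorClass.mk_le_natCast_iff_tensorRankD_le]
      have hpos : 0 < n ^ (4 * (k + 1)) := by positivity
      have := Nat.lt_div_mul_add (a := tensorRankD (sixTetra F (n ^ (k + 1)) (e ^ (k + 1)))) hpos
      rw [add_mul, one_mul]
      exact this.le

/-- **NEC for the purchase**: under `ω(K₄) ≤ 4` (`TetraFlat` over `ℂ`) the flat-summand purchase holds at
every `δ ≤ 1` and every level `n ≥ 2`. [cite: ChristandlVranaZuiddam2016, §1.1] -/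
theorem flatPurchase_of_omegaTetra_le_four (hT : omegaTetra F ≤ 4) {δ : ℝ} (hδ1 : δ ≤ 1) {n : ℕ}
    (hn : 2 ≤ n) :
    AsympLe (fun x y : DTensorClass F 4 => x ≤ y) (DTensorClass.mk (sixTetra F n (rectDim n δ)))
      (DTensorClass.mk (sixTetra F n 1) + ((n ^ 4 : ℕ) : DTensorClass F 4)) := by
  have he : rectDim n δ ≤ n := by simpa using rectDim_mono (by omega : 1 ≤ n) hδ1
  exact flatPurchase_of_absolute F (absolutePurchase_of_omegaTetra_le_four F hT hn he)

/-- **NEC**: `ω = 2 ⟹` the flat-summand purchase at every `δ ≤ 1` and every level `n ≥ 2`.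
[cite: ChristandlVranaZuiddam2016, §1.1] -/
theorem flatPurchase_of_matrixMultiplication (hS : _root_.MatrixMultiplication) {δ : ℝ} (hδ1 : δ ≤ 1)
    {n : ℕ} (hn : 2 ≤ n) :
    AsympLe (fun x y : DTensorClass ℂ 4 => x ≤ y) (DTensorClass.mk (sixTetra ℂ n (rectDim n δ)))
      (DTensorClass.mk (sixTetra ℂ n 1) + ((n ^ 4 : ℕ) : DTensorClass ℂ 4)) :=
  flatPurchase_of_omegaTetra_le_four ℂ (omegaTetra_le_four_of_matrixMultiplication hS) hδ1 hn

/-- `TetraFlat ⟹` the purchase everywhere (the purchase sits between `TetraFlat` and the rung).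
[cite: ChristandlVranaZuiddam2016, §1.1] -/
theorem flatPurchase_of_tetraFlat (hT : TetraFlat) {δ : ℝ} (hδ1 : δ ≤ 1) {n : ℕ} (hn : 2 ≤ n) :
    AsympLe (fun x y : DTensorClass ℂ 4 => x ≤ y) (DTensorClass.mk (sixTetra ℂ n (rectDim n δ)))
      (DTensorClass.mk (sixTetra ℂ n 1) + ((n ^ 4 : ℕ) : DTensorClass ℂ 4)) :=
  flatPurchase_of_omegaTetra_le_four ℂ hT hδ1 hn

end Nec

end Summit.MatrixMultiplication.MatrixMultiplication.Theorems.EdgePencil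

end
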